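/-
Origin: expansion seat `planner-pub-hodgecm-pv02-g5-0`, handover #2 2026-08-18T08:38:53Z (`HOME/pub-hodgecm-pv02-g5/lean/Pv02g5/ArchAWeilFinite.lean`, md5 7cbe09e7, 323 lines);
landed by the gen-7 packager in gate run 27 as `HodgeCM/PerL34/ArchAWeilFinite.lean` (import ^import Pv[0-9]+g[0-9]+\.→import HodgeCM.PerL34. ×1).
-/
/-
Origin: HOME/pub-hodgecm-pv02-g5/lean/Pv02g5/ArchAWeilFinite.lean (module `Pv02g5.ArchAWeilFinite`; the packager
renames to `HodgeCM.PerL34.ArchAWeilFinite` and rewrites `import Pv02g5.ArchAWeil` ↦ `import HodgeCM.PerL34.ArchAWeil`)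
— session planner-pub-hodgecm-pv02-g5-0 (unit pub-hodgecm-pv02-g5, DAG-NODE PROVER #02 gen 5).
DAG node (HOME/LEMMAS.md v13 §1): N27 = PerL v5 Lemma 4.1(a) — the PRINT input `WeightDecomposition`
([BW] VIII 2.7(1)) of N27 over the Weil theta model REDUCED to `K`-finiteness (DEFINITIONAL for `𝒮^κ`).
Imports: this seat's `ArchAWeil` (HANDOVER #1, run 27) + tree `HodgeCM.PerL34.CircleCharacters` (pv01, run 19).
-/
import Summits.HodgeConjecture.HodgeCM.PerL34.ArchAWeil_2
import Summits.HodgeConjecture.HodgeCM.PerL34.CircleCharacters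

/-!
# Finite-dimensional representations of `U(1)` are sums of integer weight spaces; N27's
# `WeightDecomposition` over the Weil theta model from `K`-finiteness

§1 (`HodgeCM.PerL34.CircleWeights`, pure Mathlib + pv01's `CircleChar.existsUnique_zpow_complex`):
**`iSup_weightSpace_eq_top`** — if `U(1)` acts on a finite-dimensional complex vector space `W` (any Hausdorff
vector-space topology) by `ρ : Circle →* End W` with continuous orbit maps `u ↦ ρ(u)x`, then
`W = ⨆_{k ∈ ℤ} W_k`, `W_k := {x | ∀ u, ρ(u)x = u^k x}`.  This is the representation-theoretic content of
[BW] VIII 2.7(1) ("`L² = ⊕_k L²_k`" for `K`-finite vectors) for the compact group `U(1)`, KERNEL-PROVED: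
roots of unity act semisimply (`X^n - 1` is squarefree over `ℂ`), a commuting family of semisimple operators
has a spanning set of joint eigenspaces (Mathlib `Module.End.iSup_iInf_maxGenEigenspace_eq_top_of_…_commute`),
a joint eigenvector of the (dense) torsion of `U(1)` is, by closedness of lines in a Hausdorff finite-dimensional
space, an eigenvector of every `ρ(u)`, and the resulting continuous character `U(1) → ℂˣ` is `u ↦ u^k`
(`CircleChar.existsUnique_zpow_complex`, pv01, run 19).

§2 (`HodgeCM.PerL34.ArchAWeil`): applied to the kernel side of `ArchAWeil` — for a Weil theta model `M` of a
hermitian LINE and continuous real-place circles `ι_b : U(1) →* U(W_i)(𝔸)`: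
**`weightDecomposition_of_orbitFinite : (∀ b, Continuous (ι b)) → OrbitFinite M ι → WeightDecomposition`**, where
`OrbitFinite M ι` := for every `Φ ∈ 𝒮^κ` and every real place `b`, the kernels `θ_{ω(ι_b u)Φ}`, `u ∈ U(1)`, span a
FINITE-DIMENSIONAL space — i.e. `Φ` is `U(W_{i,b})(ℝ)`-finite read through `θ`, which is the DEFINITION of
`𝒮^κ = pr_κ(𝒫)`, `𝒫` = the `K_∞`-finite (Fock / polynomial) vectors (PerL v5 ll. 263–264, 473; [BW] VIII 2.10);
hence **`N27_ofWeilModel_finite (hι) (hfin : OrbitFinite M ι) : (lineData M ι₁ ι kJ).N27_statement`**.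

NET EFFECT on N27 over the Weil theta model (cf. `ArchAWeil`, GAPS pv02g5-K1): the residual PRINT input
`KernelWeightDecomposition` / `WeightDecomposition` ([BW] VIII 2.7(1): "every vector of `𝒮^κ` is a finite sum of
`U(W_{i,b})`-weight vectors WITH INTEGER WEIGHTS") is replaced by the strictly weaker, DEFINITIONAL `OrbitFinite`
(finite-dimensionality of `U(1)`-orbits) plus continuity of `ι_b`; that integer weights exhaust a finite-dimensional
continuous `U(1)`-module is now a theorem of the package.

VACUITY NOTE.  §1 has no Prop hypotheses beyond continuity (satisfied e.g. by the trivial action, and by every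
`u ↦ u^k` on `ℂ`); §2's `OrbitFinite` holds trivially when `𝒮^κ = ∅` and in the intended model by definition of
`𝒫`; no statement of N27 is among the hypotheses.
-/

set_option autoImplicit false

noncomputable section

open Module Module.End Polynomial Topology

attribute [-instance] Quotient.instMeasurableSpace

namespace HodgeCM
namespace PerL34

/-! ## 1. Finite-dimensional continuous representations of `U(1)` -/

namespace CircleWeights

/-- The roots of unity are dense in `U(1)`. -/
theorem dense_isOfFinOrder : Dense {u : Circle | IsOfFinOrder u} := by
  have h1 : DenseRange (fun r : ℝ => Circle.exp (2 * Real.pi * r)) := by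
    refine Function.Surjective.denseRange fun z => ?_
    obtain ⟨x, rfl⟩ := Circle.exp_surjective z
    exact ⟨x / (2 * Real.pi), by rw [mul_div_cancel₀ _ (by positivity)]⟩
  have hd : DenseRange (fun q : ℚ => Circle.exp (2 * Real.pi * (q : ℝ))) :=
    h1.comp Rat.denseRange_cast (Circle.exp.continuous.comp (continuous_const.mul continuous_id))
  refine Dense.mono ?_ hd
  rintro _ ⟨q, rfl⟩
  refine isOfFinOrder_iff_pow_eq_one.mpr ⟨q.den, q.den_pos, ?_⟩
  have hq : (q.den : ℝ) * (q : ℝ) = (q.num : ℝ) := by exact_mod_cast Rat.den_mul_eq_num q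
  rw [← Circle.exp_natCast_mul, ← mul_assoc, mul_comm (q.den : ℝ) (2 * Real.pi), mul_assoc, hq,
    Circle.exp_two_pi_mul_int]

variable {W : Type*} [AddCommGroup W] [Module ℂ W]

/-- An endomorphism of finite order of a complex vector space is semisimple (`X^n - 1` is squarefree
over `ℂ`). -/
theorem isSemisimple_of_pow_eq_one {f : Module.End ℂ W} {n : ℕ} (hn : 0 < n) (hf : f ^ n = 1) :
    f.IsSemisimple := by
  refine Module.End.isSemisimple_of_squarefree_aeval_eq_zero (p := X ^ n - C 1) ?_ ?_
  · exact (Polynomial.separable_X_pow_sub_C (1 : ℂ) (Nat.cast_ne_zero.mpr hn.ne') one_ne_zero).squarefree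
  · rw [map_sub, map_pow, aeval_X, aeval_C, map_one, hf, sub_self]

/-- The `k`-th weight space of a `U(1)`-action: `{x | ∀ u, ρ(u)x = u^k • x}` — the SAME formula as
`HodgeCM.PerL34.Fock.weightSpace` (`ArchAFock`, pv02-g4) and as the `piece`s of `ArchA.LineArchData`; restated here only to
keep this file's imports light (no Fock-model modules). -/
def weightSpace (ρ : Circle →* Module.End ℂ W) (k : ℤ) : Submodule ℂ W :=
  ⨅ u : Circle, eigenspace (ρ u) ((u : ℂ) ^ k)

/-- (Ported verbatim from the HodgeCMPerL package; no docstring in the source.) -/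
theorem mem_weightSpace_iff (ρ : Circle →* Module.End ℂ W) (k : ℤ) (x : W) :
    x ∈ weightSpace ρ k ↔ ∀ u : Circle, ρ u x = ((u : ℂ) ^ k) • x := by
  simp only [weightSpace, Submodule.mem_iInf, mem_eigenspace_iff]

variable [FiniteDimensional ℂ W] [TopologicalSpace W] [IsTopologicalAddGroup W] [ContinuousSMul ℂ W] [T2Space W]

/-- **A finite-dimensional continuous representation of `U(1)` is the sum of its integer weight spaces**
([BW] VIII 2.7(1) for `U(1)`, kernel-proved). -/
theorem iSup_weightSpace_eq_top (ρ : Circle →* Module.End ℂ W) (hρ : ∀ x : W, Continuous fun u => ρ u x) :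
    ⨆ k : ℤ, weightSpace ρ k = ⊤ := by
  classical
  -- (A) the torsion of `U(1)` acts by a commuting family of semisimple operators: joint eigenspaces span
  let T := {u : Circle // IsOfFinOrder u}
  let f : T → Module.End ℂ W := fun t => ρ t.1
  have hcomm : Pairwise fun i j => Commute (f i) (f j) := fun i j _ => by
    change ρ i.1 * ρ j.1 = ρ j.1 * ρ i.1
    rw [← map_mul, ← map_mul, mul_comm]
  have hss : ∀ t : T, (f t).IsFinitelySemisimple := fun t => by
    rw [Module.End.isFinitelySemisimple_iff_isSemisimple]
    obtain ⟨n, hn, hn1⟩ := isOfFinOrder_iff_pow_eq_one.mp t.2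
    exact isSemisimple_of_pow_eq_one hn (by rw [← map_pow, hn1, map_one])
  have htop : ⨆ χ : T → ℂ, ⨅ t, eigenspace (f t) (χ t) = ⊤ := by
    have h := Module.End.iSup_iInf_maxGenEigenspace_eq_top_of_iSup_maxGenEigenspace_eq_top_of_commute f
      hcomm fun t => Module.End.iSup_maxGenEigenspace_eq_top (f t)
    have e : ∀ (t : T) (μ : ℂ), (f t).maxGenEigenspace μ = (f t).eigenspace μ := fun t μ =>
      (hss t).maxGenEigenspace_eq_eigenspace μ
    simp_rw [e] at h
    exact h
  -- (B) each joint eigenspace of the torsion lies in an integer weight space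
  rw [eq_top_iff, ← htop]
  refine iSup_le fun χ => fun x hx => ?_
  by_cases hx0 : x = 0
  · rw [hx0]; exact Submodule.zero_mem _
  have hxT : ∀ t : T, ρ t.1 x = χ t • x := fun t =>
    mem_eigenspace_iff.mp ((Submodule.mem_iInf _).mp hx t)
  -- the line through `x` is closed and contains `ρ(u)x` for the dense set of torsion `u`, hence for all `u`
  let L : Submodule ℂ W := ℂ ∙ x
  have hLc : IsClosed (L : Set W) := L.closed_of_finiteDimensional
  have hS : ∀ u : Circle, ρ u x ∈ L := by
    have hcl : IsClosed {u : Circle | ρ u x ∈ L} := hLc.preimage (hρ x)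
    have hsub : {u : Circle | IsOfFinOrder u} ⊆ {u : Circle | ρ u x ∈ L} := fun u hu => by
      simp only [Set.mem_setOf_eq, hxT ⟨u, hu⟩]
      exact L.smul_mem _ (Submodule.mem_span_singleton_self x)
    have huniv : {u : Circle | ρ u x ∈ L} = Set.univ := by
      rw [← hcl.closure_eq]
      exact (dense_isOfFinOrder.mono hsub).closure_eq
    exact fun u => Set.eq_univ_iff_forall.mp huniv u
  -- a linear functional normalised at `x`, and the character `c(u) := ℓ(ρ(u)x)`
  obtain ⟨ℓ, hℓ⟩ := LinearMap.exists_leftInverse_of_injective (LinearMap.toSpanSingleton ℂ W x)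
    (LinearMap.ker_toSpanSingleton ℂ hx0)
  have hℓx : ∀ a : ℂ, ℓ (a • x) = a := fun a => by
    have h := LinearMap.congr_fun hℓ a
    simpa only [LinearMap.comp_apply, LinearMap.toSpanSingleton_apply, LinearMap.id_apply] using h
  have hc : ∀ u : Circle, ρ u x = ℓ (ρ u x) • x := fun u => by
    obtain ⟨a, ha⟩ := Submodule.mem_span_singleton.mp (hS u)
    rw [← ha, hℓx]
  let c : Circle →* ℂ :=
    { toFun := fun u => ℓ (ρ u x)
      map_one' := by
        rw [map_one, Module.End.one_apply]
        simpa only [one_smul] using hℓx 1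
      map_mul' := fun u v => by
        have hv := hc v
        have hu := hc u
        set a := ℓ (ρ v x)
        set b := ℓ (ρ u x)
        rw [map_mul, Module.End.mul_apply, hv, map_smul, hu, smul_smul, hℓx, mul_comm] }
  have hcc : Continuous c := ℓ.continuous_of_finiteDimensional.comp (hρ x)
  obtain ⟨n, hn, -⟩ := CircleChar.existsUnique_zpow_complex c hcc
  refine Submodule.mem_iSup_of_mem n ((mem_weightSpace_iff ρ n x).mpr fun u => ?_)
  rw [hc u]
  exact congrArg (· • x) (hn u)

end CircleWeights

/-! ## 2. N27's `WeightDecomposition` over the Weil theta model from `K`-finiteness -/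

namespace ArchAWeil

open ArchA MeasureTheory

section Finite

variable {GU : Type} [Group GU] [TopologicalSpace GU] {ΓU : Subgroup GU}
variable {G : Type} [CommGroup G] [TopologicalSpace G] [IsTopologicalGroup G] {Γ : Subgroup G}

/-- The translation action packaged as a representation of `U(W_i)(𝔸)` on all kernels. -/
def translHom : G →* Module.End ℂ C((GU ⧸ ΓU) × (G ⧸ Γ), ℂ) where
  toFun := transl
  map_one' := LinearMap.ext transl_one
  map_mul' h h' := LinearMap.ext (transl_mul h h')

/-- (Ported verbatim from the HodgeCMPerL package; no docstring in the source.) -/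
@[simp] theorem translHom_apply (h : G) : translHom (ΓU := ΓU) (Γ := Γ) h = transl h := rfl

/-- `u ↦ T_{ι(u)} F` is continuous on `U(1)` for every kernel `F` and every continuous `ι : U(1) →* U(W_i)(𝔸)`. -/
theorem continuous_transl_apply {ι : Circle →* G} (hι : Continuous ι) (F : C((GU ⧸ ΓU) × (G ⧸ Γ), ℂ)) :
    Continuous fun u : Circle => transl (ΓU := ΓU) (Γ := Γ) (ι u) F := by
  let Ψ : C(Circle × ((GU ⧸ ΓU) × (G ⧸ Γ)), ℂ) :=
    ⟨fun z => F (z.2.1, ι z.1⁻¹ • z.2.2),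
      F.continuous.comp ((continuous_fst.comp continuous_snd).prodMk
        ((hι.comp (continuous_inv.comp continuous_fst)).smul (continuous_snd.comp continuous_snd)))⟩
  have h : (fun u : Circle => transl (ΓU := ΓU) (Γ := Γ) (ι u) F) = fun u => Ψ.curry u := by
    funext u
    ext p
    change F (p.1, (ι u)⁻¹ • p.2) = F (p.1, ι u⁻¹ • p.2)
    rw [map_inv]
  rw [h]
  exact Ψ.curry.continuous

/-- Restricting a representation to a stable submodule. -/
def restrictHom {Gr : Type*} [Monoid Gr] {E : Type*} [AddCommGroup E] [Module ℂ E]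
    (τ : Gr →* Module.End ℂ E) (V : Submodule ℂ E) (hV : ∀ g, ∀ x ∈ V, τ g x ∈ V) :
    Gr →* Module.End ℂ V where
  toFun g := (τ g).restrict (hV g)
  map_one' := by
    refine LinearMap.ext fun x => Subtype.ext ?_
    rw [LinearMap.coe_restrict_apply, map_one]
    rfl
  map_mul' g g' := by
    refine LinearMap.ext fun x => Subtype.ext ?_
    rw [LinearMap.coe_restrict_apply, map_mul, Module.End.mul_apply, Module.End.mul_apply,
      LinearMap.coe_restrict_apply, LinearMap.coe_restrict_apply]

/-- (Ported verbatim from the HodgeCMPerL package; no docstring in the source.) -/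
@[simp] theorem coe_restrictHom_apply {Gr : Type*} [Monoid Gr] {E : Type*} [AddCommGroup E] [Module ℂ E]
    (τ : Gr →* Module.End ℂ E) (V : Submodule ℂ E) (hV : ∀ g, ∀ x ∈ V, τ g x ∈ V) (g : Gr) (x : V) :
    ((restrictHom τ V hV g x : V) : E) = τ g x := rfl

variable [IsTopologicalGroup GU] (M : WeilThetaModel GU ΓU G Γ) {RealPl : Type} (ι : RealPl → (Circle →* G))

/-- The span of the kernels of the `U(W_{i,b})`-orbit of `Φ ∈ 𝒮^κ`. -/
def orbitSpan (b : RealPl) (Φ : M.SK) : Submodule ℂ C((GU ⧸ ΓU) × (G ⧸ Γ), ℂ) :=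
  Submodule.span ℂ (Set.range fun u : Circle => M.θ (M.omg (ι b u) Φ))

/-- **`K`-finiteness read on kernels** (DEFINITIONAL for `𝒮^κ = pr_κ(𝒫)`, `𝒫` = `K_∞`-finite vectors, PerL v5
ll. 263–264 / 473, [BW] VIII 2.10): for every `Φ ∈ 𝒮^κ` and every real place `b`, the kernels
`θ_{ω(ι_b u)Φ}`, `u ∈ U(W_{i,b}) = U(1)`, span a finite-dimensional space. -/
def OrbitFinite : Prop :=
  ∀ (b : RealPl) (Φ : M.SK), FiniteDimensional ℂ (orbitSpan M ι b Φ)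

/-- (Ported verbatim from the HodgeCMPerL package; no docstring in the source.) -/
theorem θ_omg_mem_orbitSpan (b : RealPl) (Φ : M.SK) (u : Circle) :
    M.θ (M.omg (ι b u) Φ) ∈ orbitSpan M ι b Φ :=
  Submodule.subset_span ⟨u, rfl⟩

/-- (Ported verbatim from the HodgeCMPerL package; no docstring in the source.) -/
theorem θ_mem_orbitSpan (b : RealPl) (Φ : M.SK) : M.θ Φ ∈ orbitSpan M ι b Φ := by
  have h : M.θ (M.omg (ι b 1) Φ) = M.θ Φ := by
    rw [map_one, ← transl_θ, transl_one]
  exact h ▸ θ_omg_mem_orbitSpan M ι b Φ 1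

/-- The orbit span is stable under `T_{ι_b(v)}`. -/
theorem transl_mem_orbitSpan (b : RealPl) (Φ : M.SK) (v : Circle)
    {F : C((GU ⧸ ΓU) × (G ⧸ Γ), ℂ)} (hF : F ∈ orbitSpan M ι b Φ) :
    transl (ι b v) F ∈ orbitSpan M ι b Φ := by
  have hle : Submodule.map (transl (ι b v)) (orbitSpan M ι b Φ) ≤ orbitSpan M ι b Φ := by
    rw [orbitSpan, Submodule.map_span_le]
    rintro _ ⟨u, rfl⟩
    dsimp only
    rw [← transl_θ, ← transl_mul, ← map_mul, transl_θ]
    exact θ_omg_mem_orbitSpan M ι b Φ (v * u)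
  exact hle (Submodule.mem_map_of_mem hF)

/-- (Ported verbatim from the HodgeCMPerL package; no docstring in the source.) -/
theorem orbitSpan_le_kerSpan (b : RealPl) (Φ : M.SK) : orbitSpan M ι b Φ ≤ kerSpan M := by
  rw [orbitSpan]
  refine Submodule.span_le.mpr ?_
  rintro _ ⟨u, rfl⟩
  exact θ_mem_kerSpan M _

/-- `U(W_{i,b})` on the orbit span of `Φ`. -/
def orbitRep (b : RealPl) (Φ : M.SK) : Circle →* Module.End ℂ (orbitSpan M ι b Φ) :=
  restrictHom (translHom.comp (ι b)) (orbitSpan M ι b Φ) fun v _ hF => transl_mem_orbitSpan M ι b Φ v hF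

/-- (Ported verbatim from the HodgeCMPerL package; no docstring in the source.) -/
@[simp] theorem coe_orbitRep_apply (b : RealPl) (Φ : M.SK) (u : Circle) (y : orbitSpan M ι b Φ) :
    ((orbitRep M ι b Φ u y : orbitSpan M ι b Φ) : C((GU ⧸ ΓU) × (G ⧸ Γ), ℂ)) =
      transl (ι b u) (y : C((GU ⧸ ΓU) × (G ⧸ Γ), ℂ)) := rfl

variable [CompactSpace (GU ⧸ ΓU)] [CompactSpace (G ⧸ Γ)] [MeasurableSpace (G ⧸ Γ)] [BorelSpace (G ⧸ Γ)]
variable (ι₁ : RealPl) (kJ : RealPl → ℤ)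

/-- A kernel `θ_Φ` with finite-dimensional `U(W_{i,b})`-orbit span is a finite sum of INTEGER-weight kernels. -/
theorem θ_mem_iSup_piece {b : RealPl} (hι : Continuous (ι b)) (Φ : M.SK)
    (hfin : FiniteDimensional ℂ (orbitSpan M ι b Φ)) :
    (⟨M.θ Φ, θ_mem_kerSpan M Φ⟩ : kerSpan M) ∈ ⨆ k, (lineData M ι₁ ι kJ).piece b k := by
  haveI := hfin
  -- §1 applied to the orbit span
  have hcont : ∀ x : orbitSpan M ι b Φ, Continuous fun u => orbitRep M ι b Φ u x := fun x =>
    (continuous_transl_apply (ΓU := ΓU) (Γ := Γ) hι x.1).subtype_mk fun u =>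
      transl_mem_orbitSpan M ι b Φ u x.2
  have htop := CircleWeights.iSup_weightSpace_eq_top (orbitRep M ι b Φ) hcont
  -- push forward along the (equivariant) inclusion `orbitSpan ≤ kerSpan`
  have hj : ∀ k : ℤ, Submodule.map (Submodule.inclusion (orbitSpan_le_kerSpan M ι b Φ))
      (CircleWeights.weightSpace (orbitRep M ι b Φ) k) ≤ (lineData M ι₁ ι kJ).piece b k := fun k => by
    refine Submodule.map_le_iff_le_comap.mpr fun y hy => ?_
    rw [CircleWeights.mem_weightSpace_iff] at hy
    refine (Submodule.mem_iInf _).mpr fun u => mem_eigenspace_iff.mpr (Subtype.ext ?_)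
    have hyu := congrArg Subtype.val (hy u)
    rw [coe_orbitRep_apply, Submodule.coe_smul] at hyu
    rw [MonoidHom.comp_apply, coe_omega_apply, Submodule.coe_smul, Submodule.coe_inclusion]
    exact hyu
  have hx : (⟨M.θ Φ, θ_mem_orbitSpan M ι b Φ⟩ : orbitSpan M ι b Φ) ∈
      ⨆ k, CircleWeights.weightSpace (orbitRep M ι b Φ) k := by
    rw [htop]; exact Submodule.mem_top
  have hjx : Submodule.inclusion (orbitSpan_le_kerSpan M ι b Φ) ⟨M.θ Φ, θ_mem_orbitSpan M ι b Φ⟩ =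
      (⟨M.θ Φ, θ_mem_kerSpan M Φ⟩ : kerSpan M) := rfl
  rw [← hjx]
  have hmap : Submodule.map (Submodule.inclusion (orbitSpan_le_kerSpan M ι b Φ))
      (⨆ k, CircleWeights.weightSpace (orbitRep M ι b Φ) k) ≤ ⨆ k, (lineData M ι₁ ι kJ).piece b k := by
    rw [Submodule.map_iSup]
    exact iSup_mono hj
  exact hmap (Submodule.mem_map_of_mem hx)

/-- **`WeightDecomposition` of N27 over the Weil theta model from `K`-finiteness** (and continuity of the
real-place circles): the [BW] VIII 2.7(1) input of `ArchAWeil.N27_ofWeil` DISCHARGED modulo the DEFINITIONAL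
`OrbitFinite`. -/
theorem weightDecomposition_of_orbitFinite (hι : ∀ b, Continuous (ι b)) (hfin : OrbitFinite M ι) :
    (lineData M ι₁ ι kJ).WeightDecomposition :=
  weightDecomposition_of_generators M ι₁ ι kJ fun b Φ => θ_mem_iSup_piece M ι ι₁ kJ (hι b) Φ (hfin b Φ)

/-- **N27 = PerL v5 Lemma 4.1(a) over the Weil theta model, FINAL NET FORM**: hypotheses = the model `M`
(prl1-g4), the DATA `ι` (continuous real-place circles) and `kJ` ([BW] weight names), and the DEFINITIONAL
`OrbitFinite M ι` (`𝒮^κ` consists of `U(W_{i,b})(ℝ)`-finite vectors, read on kernels); conclusion = pv02's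
verbatim rendering `N27_statement` for the line datum `lineData M ι₁ ι kJ`.  No PRINT input of N27 remains. -/
theorem N27_ofWeilModel_finite (hι : ∀ b, Continuous (ι b)) (hfin : OrbitFinite M ι) :
    (lineData M ι₁ ι kJ).N27_statement :=
  N27_ofWeil M ι₁ ι kJ (weightDecomposition_of_orbitFinite M ι ι₁ kJ hι hfin)

end Finite

end ArchAWeil

end PerL34
end HodgeCM

end
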